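import Literature.MathematicalPhysics.QuantumFieldTheory.Balaban1983to89.B4Eq15Projection

/-!
# `Balaban1983to89.B4Eq15ProjectionLinear` — T. Bałaban, *Regularity and decay of lattice Green's functions*, Commun. Math. Phys.
**89** (1983) 571–597 [Balaban1983RegularityDecay], (1.4)–(1.5) p. 572 continued: `Q_k(A)`, `Q_k^*(A)`, `P_k(A)` as LINEAR OPERATORS
on the V1 field spaces, and the bridge to the one-level objects of `LatticeFieldCalculus` §10

statement-level skeleton of published theorems with citation tags; proofs where landed; nothing here is a claim about the Yang–Mills mass gap

PDF held: `paper:balaban1983-cmp89-regularity-decay` (journal page = PDF page + 570); page read as an image: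
`run/shared/lean/pub/pub-balaban/b2b-balaban-ref1/pages/1983-cmp89-regularity-decay/1983-cmp89-regularity-decay-p002-x2.png` (p. 572).

CITATION HEADER (lean-in-tree rule).  Sibling of `B4Eq15Projection` (p243130; SKELETON.md row `B4.Eq1.4-1.5`, reader r18 id A12b,
PHASE2-TARGETS.md §G.3 seat p35 = R8), split off to respect the cell's 400-line rule.  PRINT p. 572 [PDF 2]: "We consider operators on
subsets of the lattice `ηZ^d`"; (1.4) `(Q_k(A)φ)(y) = Σ_{x ∈ B^k(y)} η^d U(A(Γ^{(k)}_{y,x})) φ(x)`; (1.5) "The projection operator `P_k(A)` is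
given by `P_k(A) = Q_k^*(A) Q_k(A)`"; (1.6) `G_k(Ω, A) = (−Δ^{η,N}_{A,Ω} + m² + aP_k(A))^{-1}`; (1.2) `U(A) = e^{qeηA}`, `q` antisymmetric.
WHAT IS REPRODUCED: §1 the functions `covAvgK`/`covAvgKAdj`/`covProjK` of `B4Eq15Projection` packaged as `ℝ`-linear operators
(`covAvgKLin`, `covAvgKAdjLin`, `covProjKLin : Module.End ℝ (SiteField P i W)`), with `Q_k Q_k^* = 1` as an operator identity, `P_k`
idempotent in the endomorphism ring (`IsIdempotentElem`), `Q_k` onto / `Q_k^*` one-to-one, `ker P_k = ker Q_k`, and `P_k` the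
projection onto the range of `Q_k^*` (`LinearMap.IsProj`) — the
form in which (1.6) can be written by `Ring.inverse` on V1 (NOT done here: row B4.Eq1.6 is typed on the matrix carrier
`B4GaugeCovariance.covOp`); §2 the BRIDGE to `LatticeFieldCalculus.covSiteAvgAdj`/`covProj` (v1.2 §10 of that file, unit r18, landed the
same day; adjoint-free one-level form `U(−A(Γ_{y,x}))ψ(y)`): under (1.2) read as `⟨U(a)v, w⟩ = ⟨v, U(−a)w⟩` the two one-level adjoints
and projections are EQUAL (`covSiteAvgAdj_eq_calculus`, `covSiteProj_eq_calculus`), and two transferred theorems as samples (symmetry and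
nonnegativity of `LatticeFieldCalculus.covProj`).  Elementary; no analysis.  Unit `lit-balaban-p35` (Phase-2 proof seat p35), 2026-08-21.
-/

open scoped BigOperators InnerProductSpace

namespace Literature.MathematicalPhysics.QuantumFieldTheory.Balaban1983to89

namespace B4Eq15ProjectionLinear

open LatticeNorms B4Eq15Projection

/-! ## 1. `Q_k(A)`, `Q_k^*(A)`, `P_k(A)` as LINEAR OPERATORS on the field spaces (p. 572: "We consider operators on subsets of
the lattice"; needed to write (1.6) `G_k(Ω, A) = (−Δ + m² + aP_k(A))^{-1}` in the endomorphism ring) -/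

section Linear

variable {P : Params} {i : ℕ} {W : Type*} [NormedAddCommGroup W] [InnerProductSpace ℝ W]

/-- (1.4) as an `ℝ`-linear operator `Q_k(A) : (T^{(i)} → W) →ₗ (T^{(i+k)} → W)` (the function `covAvgK` with its linearity). [cite: Balaban1983RegularityDecay, (1.4) p.572] -/
noncomputable def covAvgKLin (k : ℕ) (T : Site P (i + k) → Site P i → W →ₗ[ℝ] W) :
    SiteField P i W →ₗ[ℝ] SiteField P (i + k) W where
  toFun := covAvgK k T
  map_add' := covAvgK_add k T
  map_smul' := covAvgK_smul k T

/-- `covAvgKLin` is `covAvgK`. [cite: Balaban1983RegularityDecay, (1.4) p.572] -/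
@[simp] theorem covAvgKLin_apply (k : ℕ) (T : Site P (i + k) → Site P i → W →ₗ[ℝ] W) (φ : SiteField P i W) :
    covAvgKLin k T φ = covAvgK k T φ := rfl

variable [FiniteDimensional ℝ W]

/-- The adjoint `Q_k^*(A)` as an `ℝ`-linear operator (the function `covAvgKAdj` with its linearity). [cite: Balaban1983RegularityDecay, (1.5) p.572] -/
noncomputable def covAvgKAdjLin (k : ℕ) (T : Site P (i + k) → Site P i → W →ₗ[ℝ] W) :
    SiteField P (i + k) W →ₗ[ℝ] SiteField P i W where
  toFun := covAvgKAdj k T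
  map_add' ψ ψ' := by
    funext x
    simp only [covAvgKAdj, Pi.add_apply, map_add]
  map_smul' c ψ := by
    funext x
    simp only [covAvgKAdj, Pi.smul_apply, map_smul, RingHom.id_apply]

/-- `covAvgKAdjLin` is `covAvgKAdj`. [cite: Balaban1983RegularityDecay, (1.5) p.572] -/
@[simp] theorem covAvgKAdjLin_apply (k : ℕ) (T : Site P (i + k) → Site P i → W →ₗ[ℝ] W) (ψ : SiteField P (i + k) W) :
    covAvgKAdjLin k T ψ = covAvgKAdj k T ψ := rfl

/-- **(1.5)** `P_k(A) = Q_k^*(A) Q_k(A)` as an element of the endomorphism ring of the fields on `T^{(i)}` (so that (1.6)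
`(−Δ^{η,N}_{A,Ω} + m² + aP_k(A))^{-1}` can be formed there). [cite: Balaban1983RegularityDecay, (1.5) p.572] -/
noncomputable def covProjKLin (k : ℕ) (T : Site P (i + k) → Site P i → W →ₗ[ℝ] W) : Module.End ℝ (SiteField P i W) :=
  covAvgKAdjLin k T ∘ₗ covAvgKLin k T

/-- `covProjKLin` is `covProjK`. [cite: Balaban1983RegularityDecay, (1.5) p.572] -/
@[simp] theorem covProjKLin_apply (k : ℕ) (T : Site P (i + k) → Site P i → W →ₗ[ℝ] W) (φ : SiteField P i W) :
    covProjKLin k T φ = covProjK k T φ := rfl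

/-- `Q_k Q_k^* = 1` as operators (orthogonal transporters, standing range). [cite: Balaban1983RegularityDecay, (1.5) p.572] -/
theorem covAvgKLin_comp_covAvgKAdjLin {k : ℕ} (hk : i + k ≤ P.m + P.K) (T : Site P (i + k) → Site P i → W →ₗ[ℝ] W)
    (hT : ∀ (y : Site P (i + k)) (x : Site P i), LinearMap.adjoint (T y x) ∘ₗ T y x = LinearMap.id) :
    covAvgKLin k T ∘ₗ covAvgKAdjLin k T = LinearMap.id :=
  LinearMap.ext fun ψ => covAvgK_covAvgKAdj hk T hT ψ

/-- `P_k P_k = P_k` in the endomorphism ring: `P_k` is an idempotent (orthogonal transporters, standing range). [cite: Balaban1983RegularityDecay, (1.5) p.572] -/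
theorem covProjKLin_isIdempotentElem {k : ℕ} (hk : i + k ≤ P.m + P.K) (T : Site P (i + k) → Site P i → W →ₗ[ℝ] W)
    (hT : ∀ (y : Site P (i + k)) (x : Site P i), LinearMap.adjoint (T y x) ∘ₗ T y x = LinearMap.id) :
    IsIdempotentElem (covProjKLin k T) :=
  LinearMap.ext fun φ => covProjK_idem hk T hT φ

/-- `Q_k` is ONTO (every block field `ψ` is an average, `ψ = Q_k(Q_k^*ψ)`; orthogonal transporters, standing range). [cite: Balaban1983RegularityDecay, (1.4) p.572] -/
theorem covAvgK_surjective {k : ℕ} (hk : i + k ≤ P.m + P.K) (T : Site P (i + k) → Site P i → W →ₗ[ℝ] W)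
    (hT : ∀ (y : Site P (i + k)) (x : Site P i), LinearMap.adjoint (T y x) ∘ₗ T y x = LinearMap.id) :
    Function.Surjective (covAvgK k T) :=
  fun ψ => ⟨covAvgKAdj k T ψ, covAvgK_covAvgKAdj hk T hT ψ⟩

/-- `Q_k^*` is ONE-TO-ONE (orthogonal transporters, standing range). [cite: Balaban1983RegularityDecay, (1.5) p.572] -/
theorem covAvgKAdj_injective {k : ℕ} (hk : i + k ≤ P.m + P.K) (T : Site P (i + k) → Site P i → W →ₗ[ℝ] W)
    (hT : ∀ (y : Site P (i + k)) (x : Site P i), LinearMap.adjoint (T y x) ∘ₗ T y x = LinearMap.id) :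
    Function.Injective (covAvgKAdj k T) :=
  Function.LeftInverse.injective (g := covAvgK k T) (covAvgK_covAvgKAdj hk T hT)

/-- `ker P_k = ker Q_k`: `1 − P_k` kills exactly the averages — the fluctuation fields are `N(Q_k)` (orthogonal transporters,
standing range). [cite: Balaban1983RegularityDecay, (1.5) p.572] -/
theorem ker_covProjKLin {k : ℕ} (hk : i + k ≤ P.m + P.K) (T : Site P (i + k) → Site P i → W →ₗ[ℝ] W)
    (hT : ∀ (y : Site P (i + k)) (x : Site P i), LinearMap.adjoint (T y x) ∘ₗ T y x = LinearMap.id) :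
    LinearMap.ker (covProjKLin k T) = LinearMap.ker (covAvgKLin k T) := by
  ext φ
  simp only [LinearMap.mem_ker, covProjKLin_apply, covAvgKLin_apply]
  constructor
  · intro h
    have h' := congrArg (covAvgK k T) h
    rw [covAvgK_covProjK hk T hT] at h'
    rw [h']
    exact map_zero (covAvgKLin k T)
  · intro h
    show covAvgKAdj k T (covAvgK k T φ) = 0
    rw [h]
    exact map_zero (covAvgKAdjLin k T)

/-- `P_k` is the projection ONTO the range of `Q_k^*` (the block-covariantly-constant fields) in Mathlib's sense
(`LinearMap.IsProj`: maps into the range and fixes it). [cite: Balaban1983RegularityDecay, (1.5) p.572] -/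
theorem covProjKLin_isProj {k : ℕ} (hk : i + k ≤ P.m + P.K) (T : Site P (i + k) → Site P i → W →ₗ[ℝ] W)
    (hT : ∀ (y : Site P (i + k)) (x : Site P i), LinearMap.adjoint (T y x) ∘ₗ T y x = LinearMap.id) :
    LinearMap.IsProj (LinearMap.range (covAvgKAdjLin k T)) (covProjKLin k T) where
  map_mem φ := ⟨covAvgKLin k T φ, rfl⟩
  map_id φ hφ := by
    obtain ⟨ψ, rfl⟩ := hφ
    exact covProjK_covAvgKAdj hk T hT ψ

end Linear

/-! ## 2. Bridge to the adjoint-free one-level objects of `LatticeFieldCalculus` v1.2 §10 (`LatticeFieldCalculus.covSiteAvgAdj`,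
`LatticeFieldCalculus.covProj`, landed the same day): under (1.2) read as "`U(−a)` is the adjoint of `U(a)`" they coincide with the
`LinearMap.adjoint` form of `B4Eq15Projection` §3, so every theorem of that file and of §1 transfers to them -/

section Bridge

variable {P : Params} {i : ℕ} {W : Type*} [NormedAddCommGroup W] [InnerProductSpace ℝ W] [FiniteDimensional ℝ W]

/-- (1.2) in the form `⟨U(a)v, w⟩ = ⟨v, U(−a)w⟩` says `U(a)^* = U(−a)` as linear maps. [cite: Balaban1983RegularityDecay, (1.2) p.572] -/
theorem adjoint_eq_neg (Urep : ℝ → W →ₗ[ℝ] W) (hU : ∀ (a : ℝ) (v w : W), ⟪Urep a v, w⟫_ℝ = ⟪v, Urep (-a) w⟫_ℝ) (a : ℝ) :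
    LinearMap.adjoint (Urep a) = Urep (-a) := by
  symm
  rw [LinearMap.eq_adjoint_iff]
  intro v w
  rw [real_inner_comm w (Urep (-a) v), ← hU a w v]
  exact real_inner_comm v (Urep a w)

/-- The two one-level adjoints AGREE under (1.2): `B4Eq15Projection.covSiteAvgAdj` (`LinearMap.adjoint` form) `=`
`LatticeFieldCalculus.covSiteAvgAdj` (the `U(−A(Γ_{y,x}))` form). [cite: Balaban1983RegularityDecay, (1.5) p.572] -/
theorem covSiteAvgAdj_eq_calculus (Urep : ℝ → W →ₗ[ℝ] W) (hU : ∀ (a : ℝ) (v w : W), ⟪Urep a v, w⟫_ℝ = ⟪v, Urep (-a) w⟫_ℝ)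
    (A : VecField P i ℝ) (ψ : SiteField P (i + 1) W) :
    covSiteAvgAdj Urep A ψ = LatticeFieldCalculus.covSiteAvgAdj Urep A ψ := by
  funext x
  rw [covSiteAvgAdj_apply, adjoint_eq_neg Urep hU]
  rfl

/-- The two one-level projections AGREE under (1.2): `B4Eq15Projection.covSiteProj = LatticeFieldCalculus.covProj`. [cite: Balaban1983RegularityDecay, (1.5) p.572] -/
theorem covSiteProj_eq_calculus (Urep : ℝ → W →ₗ[ℝ] W) (hU : ∀ (a : ℝ) (v w : W), ⟪Urep a v, w⟫_ℝ = ⟪v, Urep (-a) w⟫_ℝ)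
    (A : VecField P i ℝ) (φ : SiteField P i W) :
    covSiteProj Urep A φ = LatticeFieldCalculus.covProj Urep A φ := by
  unfold covSiteProj LatticeFieldCalculus.covProj
  rw [covSiteAvgAdj_eq_calculus Urep hU]

/-- Transfer sample: `LatticeFieldCalculus.covProj` is SYMMETRIC in the `η^d`-weighted pairing (standing range, (1.2)). [cite: Balaban1983RegularityDecay, (1.5) p.572] -/
theorem l2Inner_calculus_covProj_comm (hi : i + 1 ≤ P.m + P.K) (Urep : ℝ → W →ₗ[ℝ] W)
    (hU : ∀ (a : ℝ) (v w : W), ⟪Urep a v, w⟫_ℝ = ⟪v, Urep (-a) w⟫_ℝ) (A : VecField P i ℝ) (w : ℝ) (φ φ' : SiteField P i W) :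
    l2Inner w Finset.univ (LatticeFieldCalculus.covProj Urep A φ) φ'
      = l2Inner w Finset.univ φ (LatticeFieldCalculus.covProj Urep A φ') := by
  rw [← covSiteProj_eq_calculus Urep hU, ← covSiteProj_eq_calculus Urep hU]
  exact l2Inner_covSiteProj_comm hi Urep A w φ φ'

/-- Transfer sample: `⟨φ, Pφ⟩ = ‖Qφ‖²_{L^d w} ≥ 0` for `LatticeFieldCalculus.covProj` (standing range, (1.2), `w ≥ 0`). [cite: Balaban1983RegularityDecay, (1.5) p.572] -/
theorem l2Inner_calculus_covProj_self_nonneg (hi : i + 1 ≤ P.m + P.K) (Urep : ℝ → W →ₗ[ℝ] W)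
    (hU : ∀ (a : ℝ) (v w : W), ⟪Urep a v, w⟫_ℝ = ⟪v, Urep (-a) w⟫_ℝ) (A : VecField P i ℝ) {w : ℝ} (hw : 0 ≤ w)
    (φ : SiteField P i W) : 0 ≤ l2Inner w Finset.univ φ (LatticeFieldCalculus.covProj Urep A φ) := by
  rw [← covSiteProj_eq_calculus Urep hU, covSiteProj_eq_covProjK hi]
  exact l2Inner_covProjK_self_nonneg 1 _ hw φ

end Bridge

end B4Eq15ProjectionLinear

end Literature.MathematicalPhysics.QuantumFieldTheory.Balaban1983to89
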